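import Summits.BirchSwinnertonDyer.BirchSwinnertonDyer.Theorems.Rank2Observatory2DescKillSig2X
import Summits.BirchSwinnertonDyer.BirchSwinnertonDyer.Theorems.ShaPrimaryTransferFiniteShaComponentTransferSelmerCubicKillCertMod
import HarnessLib

/-!
# BirchSwinnertonDyer — SEL2CUBIC kill layer: the certificate `sig2xCheck` in RESIDUE form

HONEST FRAMING: route `ShaPrimaryTransfer`, seat `bsd-line-spt-p1` (g30), `--supports` item T =
`FiniteShaComponentTransfer` (stmt-22356), UNCHANGED (conjecture-grade at corank ≥ 2). BSD in rank ≥ 2 is NOT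
proved by any of this. THEOREMS ONLY.

As `…SelmerCubicKillCertMod`, for the `2`-adic TIER 2x signature certificate (one `ℤ₂`-root and a quadratic place,
`Rank2Observatory2DescKillSig2X*`): `root_rel₂_mod` (the quadratic-place relation of `…Sig2XCore` under
`m ∣ Q₁, Q₂`), `lin_rel2x_mod`, `quad_rel2x_mod`, `sig2xCheckU_sound_mod`, `sig2xCheckE_sound_mod`,
`sig2xCheck_sound_mod` — the tree's proofs verbatim under the hypothesis `2^N ∣ Q₁(v), Q₂(v)`, the statement a
`2`-Selmer class contradicts. [cite: Cassels1991LecturesEllipticCurves, §15] [cite: CremonaAlgorithms1997, §3.6]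
-/

-- single-conjunct summit: `Summit.BirchSwinnertonDyer.BirchSwinnertonDyer.…` repeats the name by design
set_option linter.dupNamespace false

namespace Summit.BirchSwinnertonDyer.BirchSwinnertonDyer.Theorems.ShaPrimaryTransferSelmerCubicKill

open Summit.BirchSwinnertonDyer.BirchSwinnertonDyer.Rank2Observatory
open Summit.BirchSwinnertonDyer.BirchSwinnertonDyer.Rank2Observatory.TwoDescKill

/-- **The kill relation at the quadratic place, residue form**: as `root_rel₂`, assuming only `m ∣ Q₁`,
`m ∣ Q₂` for the same modulus `m` (the witnesses shift by the quotients). [cite: Cassels1991LecturesEllipticCurves, §15] -/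
theorem root_rel₂_mod {m s₁ s₀ a b c : ℤ} {A : ℤ × ℤ} (hG₁ : m ∣ (pg s₁ s₀ a b c A).1)
    (hG₂ : m ∣ (pg s₁ s₀ a b c A).2) {z : ℤ × ℤ × ℤ} {t₁ t₂ r₀ r₁ r₂ n : ℤ}
    (h0₁ : m ∣ (zsq a b c z (r₀, r₁, r₂)).2.1 + t₁ * n ^ 2) (h0₂ : m ∣ (zsq a b c z (r₀, r₁, r₂)).2.2 + t₂ * n ^ 2) :
    m ∣ (qmul s₁ s₀ (pev s₁ s₀ A z) (qmul s₁ s₀ (pev s₁ s₀ A (r₀, r₁, r₂)) (pev s₁ s₀ A (r₀, r₁, r₂)))).1 -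
        ((zsq a b c z (r₀, r₁, r₂)).1 - n ^ 2 * (pev s₁ s₀ A (0, t₁, t₂)).1) ∧
      m ∣ (qmul s₁ s₀ (pev s₁ s₀ A z) (qmul s₁ s₀ (pev s₁ s₀ A (r₀, r₁, r₂)) (pev s₁ s₀ A (r₀, r₁, r₂)))).2 -
        (0 - n ^ 2 * (pev s₁ s₀ A (0, t₁, t₂)).2) := by
  obtain ⟨κ, hκ⟩ := pev_zsq s₁ s₀ a b c A z (r₀, r₁, r₂)
  obtain ⟨⟨k₁, hk₁⟩, ⟨k₂, hk₂⟩⟩ := dvd_qmul (s₁ := s₁) (s₀ := s₀) κ hG₁ hG₂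
  -- the two vanishing coordinates of the kill equation
  obtain ⟨j₁, hq₁⟩ := h0₁
  obtain ⟨j₂, hq₂⟩ := h0₂
  -- coordinates of `pev (zsq …)` read two ways
  have e₁ := congrArg Prod.fst hκ
  have e₂ := congrArg Prod.snd hκ
  simp only [pev, padd, psc] at e₁ e₂
  -- `e₁ : w₀ + w₁·A.1 + w₂·(A²).1 = main.1 + (κ·G).1`, similarly `e₂`
  refine ⟨⟨-k₁ + A.1 * j₁ + (qmul s₁ s₀ A A).1 * j₂, ?_⟩, ⟨-k₂ + A.2 * j₁ + (qmul s₁ s₀ A A).2 * j₂, ?_⟩⟩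
  · simp only [pev, padd, psc]
    linear_combination (-1 : ℤ) * e₁ + A.1 * hq₁ + (qmul s₁ s₀ A A).1 * hq₂ - hk₁
  · simp only [pev, padd, psc]
    linear_combination (-1 : ℤ) * e₂ + A.2 * hq₁ + (qmul s₁ s₀ A A).2 * hq₂ - hk₂

/-- The LINEAR root relation in `rootData` form, residue form (`root_rel_mod`). [folklore] -/
theorem lin_rel2x_mod {N : ℕ} {a b c : ℤ} {z : ℤ × ℤ × ℤ} {t₁ t₂ ε r₀ r₁ r₂ n : ℤ}
    (hg : (ε ^ 3 + a * ε ^ 2 + b * ε + c) % ((2 ^ N : ℕ) : ℤ) = 0)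
    (h0 : (2 : ℤ) ^ N ∣ (killQ a b c z t₁ t₂ (r₀, r₁, r₂, n)).1 ∧ (2 : ℤ) ^ N ∣ (killQ a b c z t₁ t₂ (r₀, r₁, r₂, n)).2) :
    (2 : ℤ) ^ N ∣ (2 : ℤ) ^ (rootData 2 N z t₁ t₂ ε).2.1 * (rootData 2 N z t₁ t₂ ε).2.2 *
        (r₀ + r₁ * ε + r₂ * ε ^ 2) ^ 2 - ((zsq a b c z (r₀, r₁, r₂)).1 - n ^ 2 * (rootData 2 N z t₁ t₂ ε).1) := by
  have h1 := root_rel_mod hg (by exact_mod_cast h0)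
  have h2 := splitPow_spec 2 N ((z.1 + z.2.1 * ε + z.2.2 * ε ^ 2) % ((2 ^ N : ℕ) : ℤ))
  simp only [Nat.cast_ofNat] at h1 h2
  simp only [rootData]
  rw [← h2]
  exact h1

/-- The QUADRATIC root relation in certificate coordinates, residue form (`root_rel₂_mod`). [folklore] -/
theorem quad_rel2x_mod {N : ℕ} {s₁ s₀ a b c : ℤ} {A : ℤ × ℤ} {z : ℤ × ℤ × ℤ} {t₁ t₂ r₀ r₁ r₂ n : ℤ} {s : ℕ}
    {Z' E : ℤ × ℤ} (hG₁ : (pg s₁ s₀ a b c A).1 % (2 : ℤ) ^ N = 0) (hG₂ : (pg s₁ s₀ a b c A).2 % (2 : ℤ) ^ N = 0)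
    (hζ : psplit N (pmod N (pev s₁ s₀ A z)) = (s, Z')) (hE : pmod N (pev s₁ s₀ A (0, t₁, t₂)) = E)
    (h0 : (2 : ℤ) ^ N ∣ (killQ a b c z t₁ t₂ (r₀, r₁, r₂, n)).1 ∧ (2 : ℤ) ^ N ∣ (killQ a b c z t₁ t₂ (r₀, r₁, r₂, n)).2) :
    (2 : ℤ) ^ N ∣ (2 : ℤ) ^ s *
        (qmul s₁ s₀ Z' (qmul s₁ s₀ (pev s₁ s₀ A (r₀, r₁, r₂)) (pev s₁ s₀ A (r₀, r₁, r₂)))).1 -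
        ((zsq a b c z (r₀, r₁, r₂)).1 - n ^ 2 * E.1) ∧
      (2 : ℤ) ^ N ∣ (2 : ℤ) ^ s *
        (qmul s₁ s₀ Z' (qmul s₁ s₀ (pev s₁ s₀ A (r₀, r₁, r₂)) (pev s₁ s₀ A (r₀, r₁, r₂)))).2 -
        (-(n ^ 2 * E.2)) := by
  obtain ⟨h₁, h₂⟩ := root_rel₂_mod (s₁ := s₁) (s₀ := s₀) (m := (2 : ℤ) ^ N) (Int.dvd_of_emod_eq_zero hG₁)
    (Int.dvd_of_emod_eq_zero hG₂) (by simpa only [killQ] using h0.1) (by simpa only [killQ] using h0.2)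
  subst hE
  obtain ⟨sp₁, sp₂⟩ := psplit_spec N (pmod N (pev s₁ s₀ A z))
  rw [hζ] at sp₁ sp₂
  simp only [pmod] at sp₁ sp₂ ⊢
  set X := qmul s₁ s₀ (pev s₁ s₀ A (r₀, r₁, r₂)) (pev s₁ s₀ A (r₀, r₁, r₂)) with hX
  -- `Z ≡ 2^s • Z'` and `T(A) ≡ Ê (mod 2^N)`
  have cZ₁ : (pev s₁ s₀ A z).1 ≡ (2 : ℤ) ^ s * Z'.1 [ZMOD (2 : ℤ) ^ N] := by
    rw [← sp₁]; exact (Int.mod_modEq _ _).symm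
  have cZ₂ : (pev s₁ s₀ A z).2 ≡ (2 : ℤ) ^ s * Z'.2 [ZMOD (2 : ℤ) ^ N] := by
    rw [← sp₂]; exact (Int.mod_modEq _ _).symm
  have cE₁ : n ^ 2 * (pev s₁ s₀ A (0, t₁, t₂)).1 ≡ n ^ 2 * ((pev s₁ s₀ A (0, t₁, t₂)).1 % (2 : ℤ) ^ N)
      [ZMOD (2 : ℤ) ^ N] := (Int.mod_modEq _ _).symm.mul_left _
  have cE₂ : n ^ 2 * (pev s₁ s₀ A (0, t₁, t₂)).2 ≡ n ^ 2 * ((pev s₁ s₀ A (0, t₁, t₂)).2 % (2 : ℤ) ^ N)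
      [ZMOD (2 : ℤ) ^ N] := (Int.mod_modEq _ _).symm.mul_left _
  obtain ⟨m₁, m₂⟩ := qmul_modEq (x' := ((2 : ℤ) ^ s * Z'.1, (2 : ℤ) ^ s * Z'.2)) (y := X) (y' := X) cZ₁ cZ₂
    (Int.ModEq.refl _) (Int.ModEq.refl _)
  have e₁ : (qmul s₁ s₀ ((2 : ℤ) ^ s * Z'.1, (2 : ℤ) ^ s * Z'.2) X).1 = (2 : ℤ) ^ s * (qmul s₁ s₀ Z' X).1 := by
    simp only [qmul]; ring
  have e₂ : (qmul s₁ s₀ ((2 : ℤ) ^ s * Z'.1, (2 : ℤ) ^ s * Z'.2) X).2 = (2 : ℤ) ^ s * (qmul s₁ s₀ Z' X).2 := by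
    simp only [qmul]; ring
  rw [e₁] at m₁
  rw [e₂] at m₂
  constructor
  · apply Int.modEq_iff_dvd.mp
    calc (zsq a b c z (r₀, r₁, r₂)).1 - n ^ 2 * ((pev s₁ s₀ A (0, t₁, t₂)).1 % (2 : ℤ) ^ N)
        ≡ (zsq a b c z (r₀, r₁, r₂)).1 - n ^ 2 * (pev s₁ s₀ A (0, t₁, t₂)).1 [ZMOD (2 : ℤ) ^ N] :=
          (Int.ModEq.refl _).sub cE₁.symm
      _ ≡ (qmul s₁ s₀ (pev s₁ s₀ A z) X).1 [ZMOD (2 : ℤ) ^ N] := Int.modEq_iff_dvd.mpr h₁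
      _ ≡ (2 : ℤ) ^ s * (qmul s₁ s₀ Z' X).1 [ZMOD (2 : ℤ) ^ N] := m₁
  · apply Int.modEq_iff_dvd.mp
    calc -(n ^ 2 * ((pev s₁ s₀ A (0, t₁, t₂)).2 % (2 : ℤ) ^ N))
        ≡ 0 - n ^ 2 * (pev s₁ s₀ A (0, t₁, t₂)).2 [ZMOD (2 : ℤ) ^ N] := by
          rw [← zero_sub]; exact (Int.ModEq.refl _).sub cE₂.symm
      _ ≡ (qmul s₁ s₀ (pev s₁ s₀ A z) X).2 [ZMOD (2 : ℤ) ^ N] := Int.modEq_iff_dvd.mpr h₂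
      _ ≡ (2 : ℤ) ^ s * (qmul s₁ s₀ Z' X).2 [ZMOD (2 : ℤ) ^ N] := m₂

/-- **Soundness of `sig2xCheckU`, residue form** (the tree's proof verbatim with `lin_rel2x_mod`, `quad_rel2x_mod`).
[cite: Cassels1991LecturesEllipticCurves, §15] [cite: CremonaAlgorithms1997, §3.6] -/
theorem sig2xCheckU_sound_mod {a b c : ℤ} {z : ℤ × ℤ × ℤ} {t₁ t₂ : ℤ} {N : ℕ} {ε s₁ s₀ p q : ℤ}
    (h : sig2xCheckU a b c z t₁ t₂ N ε s₁ s₀ p q = true) (v : ℤ × ℤ × ℤ × ℤ)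
    (hprim : ¬ ((2 : ℤ) ∣ v.1 ∧ (2 : ℤ) ∣ v.2.1 ∧ (2 : ℤ) ∣ v.2.2.1 ∧ (2 : ℤ) ∣ v.2.2.2))
    (h0 : (2 : ℤ) ^ N ∣ (killQ a b c z t₁ t₂ v).1 ∧ (2 : ℤ) ^ N ∣ (killQ a b c z t₁ t₂ v).2) :
    False := by
  obtain ⟨r₀, r₁, r₂, n⟩ := v
  simp only [sig2xCheckU, Bool.and_eq_true, Bool.not_eq_true', decide_eq_true_eq,
    decide_eq_false_iff_not, rootOK, unitOK] at h
  obtain ⟨⟨⟨⟨⟨⟨⟨⟨hs₁, hs₀⟩, hk⟩, hG₁⟩, hG₂⟩, hZ'⟩, hf⟩, hrat⟩, hwalk⟩ := h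
  have relL := lin_rel2x_mod hk.1 h0
  generalize hρ : rootData 2 N z t₁ t₂ ε = ρ at hk relL hrat hwalk
  generalize hE : pmod N (pev s₁ s₀ (p, q) (0, t₁, t₂)) = E at hrat hwalk
  generalize hζ : psplit N (pmod N (pev s₁ s₀ (p, q) z)) = ζ at hZ' hrat hwalk
  obtain ⟨s₂, Z'⟩ := ζ
  obtain ⟨relQ₁, relQ₂⟩ := quad_rel2x_mod hG₁ hG₂ hζ hE h0
  generalize hw₀ : (zsq a b c z (r₀, r₁, r₂)).1 = w₀ at relL relQ₁ relQ₂
  have hΔ := splitPow_spec 2 N (q * ((ε - p) ^ 2 - s₁ * q * (ε - p) - s₀ * q ^ 2))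
  generalize hDf : splitPow 2 N (q * ((ε - p) ^ 2 - s₁ * q * (ε - p) - s₀ * q ^ 2)) = Df at hf hwalk hΔ
  obtain ⟨D, f⟩ := Df
  simp only [Nat.cast_ofNat] at hΔ hZ' hf hwalk
  have hs₁' : ¬ (2 : ℤ) ∣ s₁ := Int.two_dvd_ne_zero.mpr hs₁
  have hs₀' : ¬ (2 : ℤ) ∣ s₀ := Int.two_dvd_ne_zero.mpr hs₀
  have hu : ¬ (2 : ℤ) ∣ ρ.2.2 := fun hd => hk.2 (Int.emod_eq_zero_of_dvd hd)
  have hfodd : ¬ (2 : ℤ) ∣ f := fun hd => hf (Int.emod_eq_zero_of_dvd hd)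
  have hZ'p : ¬ ((2 : ℤ) ∣ Z'.1 ∧ (2 : ℤ) ∣ Z'.2) := fun hh =>
    hZ' ⟨Int.emod_eq_zero_of_dvd hh.1, Int.emod_eq_zero_of_dvd hh.2⟩
  have hBN := walk2x_guard hwalk
  have hm₁ := le_max_left ρ.2.1 s₂
  have hm₂ := le_max_right ρ.2.1 s₂
  refine driver2x (cw := 0) (dw := 0) (b := false) (B := max ρ.2.1 s₂ + 2 * D) (D := D) (sq := s₂)
    (Zq := Z') (E := E) (R := pev s₁ s₀ (p, q) (r₀, r₁, r₂)) (qpat := quadPatU s₁ s₀ (s₂, Z') E)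
    hu (by omega) (by omega) relL ⟨relQ₁, relQ₂⟩ ?_ ?_ ?_ ?_ (notRat2x_spec hrat)
  · -- index + primitivity
    intro hn hRε hR1 hR2
    obtain ⟨d0, d1, d2⟩ := index12 hΔ hfodd hRε hR1 hR2
    exact hprim ⟨d0, d1, d2, hn⟩
  · -- the quadratic anchor (`sqU`)
    intro hX1 hX2
    by_contra hRR
    refine sqU hs₁' hs₀' hZ'p D _ hRR ⟨?_, ?_⟩
    · have h1 := dvd_add ((pow_dvd_pow (2 : ℤ) (show max ρ.2.1 s₂ + 2 * D + 1 ≤ N by omega)).trans relQ₁) hX1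
      rw [sub_add_cancel] at h1
      exact pow_dvd_cancel ((pow_dvd_pow _ (show (2 * D + 1) + s₂ ≤ max ρ.2.1 s₂ + 2 * D + 1 by omega)).trans h1)
    · have h2 := dvd_add ((pow_dvd_pow (2 : ℤ) (show max ρ.2.1 s₂ + 2 * D + 1 ≤ N by omega)).trans relQ₂) hX2
      rw [sub_add_cancel] at h2
      exact pow_dvd_cancel ((pow_dvd_pow _ (show (2 * D + 1) + s₂ ≤ max ρ.2.1 s₂ + 2 * D + 1 by omega)).trans h2)
  · -- the certified walk
    intro K hK hK2 y hX hR
    refine walk2x_sound (B := max ρ.2.1 s₂ + 2 * D) (N := N)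
      (P := fun y => (∃ X : ℤ, (2 : ℤ) ^ N ∣ (2 : ℤ) ^ ρ.2.1 * ρ.2.2 * X ^ 2 - (2 : ℤ) ^ K * (y - ρ.1)) ∧
        (∃ R' : ℤ × ℤ, (2 : ℤ) ^ N ∣ (2 : ℤ) ^ s₂ * (qmul s₁ s₀ Z' (qmul s₁ s₀ R' R')).1 - (2 : ℤ) ^ K * (y - E.1) ∧
          (2 : ℤ) ^ N ∣ (2 : ℤ) ^ s₂ * (qmul s₁ s₀ Z' (qmul s₁ s₀ R' R')).2 - (2 : ℤ) ^ K * (-E.2)))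
      ?_ N 0 0 hwalk y (by simp) ⟨hX, hR⟩
    intro cc j hleaf hj y' hy' hP'
    obtain ⟨hX', hR'⟩ := hP'
    simp only [Bool.or_eq_true] at hleaf
    rcases hleaf with h8 | hU
    · exact outMis8_sound hu h8 hK hK2 hj hy' hX'
    · exact outMisU_sound hs₁' hs₀' hZ'p hU hK hK2 hj hy' hR'
  · -- the quadratic core lemma in pattern form (`coreU`)
    intro μ g P8 W R' hμg hW1 hW2 hWodd hμN rel₁ rel₂
    have hWp : ¬ ((2 : ℤ) ∣ W.1 ∧ (2 : ℤ) ∣ W.2) := fun hh => hWodd hh.1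
    obtain ⟨hpar, hsq⟩ := coreU (W := W) hs₁' hs₀' hZ'p hWp μ s₂ N R' hμN rel₁ rel₂
    obtain ⟨p₁, p₂⟩ := qmul_modEq (s₁ := s₁) (s₀ := s₀) (x := Z') (x' := Z') (y := W)
      (y' := (P8 - (2 : ℤ) ^ g * E.1, -((2 : ℤ) ^ g * E.2))) (Int.ModEq.refl _) (Int.ModEq.refl _) hW1 hW2
    simp only [quadPatU, Bool.and_eq_true, decide_eq_true_eq]
    exact ⟨by omega, by rw [← isSq8_congr p₁ p₂]; exact hsq⟩

/-- **Soundness of `sig2xCheckE`, residue form** (the tree's proof verbatim with `lin_rel2x_mod`, `quad_rel2x_mod`).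
[cite: Cassels1991LecturesEllipticCurves, §15] [cite: CremonaAlgorithms1997, §3.6] -/
theorem sig2xCheckE_sound_mod {a b c : ℤ} {z : ℤ × ℤ × ℤ} {t₁ t₂ : ℤ} {N : ℕ} {ε c' d p q : ℤ}
    (h : sig2xCheckE a b c z t₁ t₂ N ε c' d p q = true) (v : ℤ × ℤ × ℤ × ℤ)
    (hprim : ¬ ((2 : ℤ) ∣ v.1 ∧ (2 : ℤ) ∣ v.2.1 ∧ (2 : ℤ) ∣ v.2.2.1 ∧ (2 : ℤ) ∣ v.2.2.2))
    (h0 : (2 : ℤ) ^ N ∣ (killQ a b c z t₁ t₂ v).1 ∧ (2 : ℤ) ^ N ∣ (killQ a b c z t₁ t₂ v).2) :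
    False := by
  obtain ⟨r₀, r₁, r₂, n⟩ := v
  simp only [sig2xCheckE, Bool.and_eq_true, Bool.not_eq_true', decide_eq_true_eq,
    decide_eq_false_iff_not, rootOK, unitOK] at h
  obtain ⟨⟨⟨⟨⟨⟨⟨hc', hk⟩, hG₁⟩, hG₂⟩, hZs⟩, hf⟩, hrat⟩, hwalk⟩ := h
  have relL := lin_rel2x_mod hk.1 h0
  generalize hρ : rootData 2 N z t₁ t₂ ε = ρ at hk relL hrat hwalk
  generalize hE : pmod N (pev (2 * d) (2 * c') (p, q) (0, t₁, t₂)) = E at hrat hwalk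
  generalize hζ : psplit N (pmod N (pev (2 * d) (2 * c') (p, q) z)) = ζ at hZs hrat hwalk
  obtain ⟨s₂, Z'⟩ := ζ
  obtain ⟨relQ₁, relQ₂⟩ := quad_rel2x_mod hG₁ hG₂ hζ hE h0
  generalize hw₀ : (zsq a b c z (r₀, r₁, r₂)).1 = w₀ at relL relQ₁ relQ₂
  have hΔ := splitPow_spec 2 N (q * ((ε - p) ^ 2 - 2 * d * q * (ε - p) - 2 * c' * q ^ 2))
  generalize hDf : splitPow 2 N (q * ((ε - p) ^ 2 - 2 * d * q * (ε - p) - 2 * c' * q ^ 2)) = Df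
    at hf hwalk hΔ
  obtain ⟨D, f⟩ := Df
  have hsd := shapeData_spec c' d (s₂, Z')
  generalize hζs : shapeData c' d (s₂, Z') = ζs at hZs hrat hwalk hsd
  obtain ⟨bb, sE, Zs⟩ := ζs
  simp only [Nat.cast_ofNat, Prod.mk.injEq] at hΔ hZs hf hwalk hsd
  have hc'odd : ¬ (2 : ℤ) ∣ c' := fun hd => hc' (Int.emod_eq_zero_of_dvd hd)
  have hu : ¬ (2 : ℤ) ∣ ρ.2.2 := fun hd => hk.2 (Int.emod_eq_zero_of_dvd hd)
  have hfodd : ¬ (2 : ℤ) ∣ f := fun hd => hf (Int.emod_eq_zero_of_dvd hd)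
  have hZs' : ¬ (2 : ℤ) ∣ Zs.1 := fun hd => hZs (Int.emod_eq_zero_of_dvd hd)
  have hBN := walk2x_guard hwalk
  have hm₁ := le_max_left ρ.2.1 sE
  have hm₂ := le_max_right ρ.2.1 sE
  -- the shape-normalised quadratic relation
  have relQ : (2 : ℤ) ^ N ∣ (2 : ℤ) ^ sE * (qmul (2 * d) (2 * c') Zs (qmul (2 * d) (2 * c')
        (pev (2 * d) (2 * c') (p, q) (r₀, r₁, r₂)) (pev (2 * d) (2 * c') (p, q) (r₀, r₁, r₂)))).1 -
        (wtw c' d bb (w₀ - n ^ 2 * E.1, -(n ^ 2 * E.2))).1 ∧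
      (2 : ℤ) ^ N ∣ (2 : ℤ) ^ sE * (qmul (2 * d) (2 * c') Zs (qmul (2 * d) (2 * c')
        (pev (2 * d) (2 * c') (p, q) (r₀, r₁, r₂)) (pev (2 * d) (2 * c') (p, q) (r₀, r₁, r₂)))).2 -
        (wtw c' d bb (w₀ - n ^ 2 * E.1, -(n ^ 2 * E.2))).2 := by
    rcases hsd with ⟨rfl, rfl, rfl⟩ | ⟨⟨rfl, rfl, rfl⟩, hev⟩
    · exact ⟨relQ₁, relQ₂⟩
    · exact wmul_rel (by show (2 : ℤ) * (c' * Z'.2) = Z'.2 * (2 * c'); ring)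
        (by show (2 : ℤ) * (Z'.1 / 2 + d * Z'.2) = Z'.1 + Z'.2 * (2 * d)
            linear_combination Int.mul_ediv_cancel' hev) relQ₁ relQ₂
  refine driver2x (cw := c') (dw := d) (b := bb) (B := max ρ.2.1 sE + 2 * D + 1) (D := D) (sq := sE)
    (Zq := Zs) (E := E) (R := pev (2 * d) (2 * c') (p, q) (r₀, r₁, r₂)) (qpat := quadPatE c' d (bb, sE, Zs) E)
    hu (by omega) (by omega) relL relQ ?_ ?_ ?_ ?_ (notRat2x_spec hrat)
  · -- index + primitivity
    intro hn hRε hR1 hR2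
    obtain ⟨d0, d1, d2⟩ := index12 hΔ hfodd hRε hR1 hR2
    exact hprim ⟨d0, d1, d2, hn⟩
  · -- the quadratic anchor (`sqE`, first coordinate of `w^b·(…)`)
    intro hX1 hX2
    by_contra hRR
    obtain ⟨w1, -⟩ := wtw_dvd c' d bb (x := (w₀ - n ^ 2 * E.1, -(n ^ 2 * E.2))) hX1 hX2
    have h1 := dvd_add ((pow_dvd_pow (2 : ℤ) (show max ρ.2.1 sE + 2 * D + 1 + 1 ≤ N by omega)).trans relQ.1) w1
    rw [sub_add_cancel] at h1
    exact sqE hc'odd hZs' D _ hRR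
      (pow_dvd_cancel ((pow_dvd_pow _ (show (2 * D + 2) + sE ≤ max ρ.2.1 sE + 2 * D + 1 + 1 by omega)).trans h1))
  · -- the certified walk
    intro K hK hK2 y hX hR
    refine walk2x_sound (B := max ρ.2.1 sE + 2 * D + 1) (N := N)
      (P := fun y => (∃ X : ℤ, (2 : ℤ) ^ N ∣ (2 : ℤ) ^ ρ.2.1 * ρ.2.2 * X ^ 2 - (2 : ℤ) ^ K * (y - ρ.1)) ∧
        (∃ R' : ℤ × ℤ,
          (2 : ℤ) ^ N ∣ (2 : ℤ) ^ sE * (qmul (2 * d) (2 * c') Zs (qmul (2 * d) (2 * c') R' R')).1 -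
              (2 : ℤ) ^ K * (wtw c' d bb (y - E.1, -E.2)).1 ∧
            (2 : ℤ) ^ N ∣ (2 : ℤ) ^ sE * (qmul (2 * d) (2 * c') Zs (qmul (2 * d) (2 * c') R' R')).2 -
              (2 : ℤ) ^ K * (wtw c' d bb (y - E.1, -E.2)).2))
      ?_ N 0 0 hwalk y (by simp) ⟨hX, hR⟩
    intro cc j hleaf hj y' hy' hP'
    obtain ⟨hX', hR'⟩ := hP'
    simp only [Bool.or_eq_true] at hleaf
    rcases hleaf with h8 | hE'
    · exact outMis8_sound hu h8 hK hK2 hj hy' hX'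
    · exact outMisE_sound hc'odd hZs' hE' hK hK2 hj hy' hR'
  · -- the quadratic core lemma in pattern form (`coreE`; with the shape bit set, `shapeE` excludes the case)
    intro μ g P8 W R' hμg hW1 hW2 hWodd hμN rel₁ rel₂
    cases bb with
    | true =>
      exfalso
      refine shapeE (c := c') (d := d) (W := qmul (2 * d) (2 * c') (0, 1) W) hc'odd hZs' ?_ ?_ μ sE N R' hμN
        rel₁ rel₂
      · exact ⟨W.2 * c', by simp only [qmul]; ring⟩
      · intro h2
        apply hWodd
        have e : W.1 = (qmul (2 * d) (2 * c') (0, 1) W).2 - 2 * (W.2 * d) := by simp only [qmul]; ring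
        rw [e]
        exact dvd_sub h2 (Dvd.intro _ rfl)
    | false =>
      have hsq := coreE (c := c') (d := d) (W := W) hc'odd hZs' hWodd μ sE N R' hμN rel₁ rel₂
      rw [etw_congr c' d (show (sE + μ) % 2 = (sE + g) % 2 by omega)] at hsq
      obtain ⟨p₁, p₂⟩ := qmul_modEq (s₁ := 2 * d) (s₀ := 2 * c') (x := Zs) (x' := Zs) (y := W)
        (y' := (P8 - (2 : ℤ) ^ g * E.1, -((2 : ℤ) ^ g * E.2))) (Int.ModEq.refl _) (Int.ModEq.refl _) hW1 hW2
      obtain ⟨q₁, q₂⟩ := etw_modEq c' d (sE + g) p₁ p₂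
      simp only [quadPatE, Bool.not_false, Bool.true_and]
      rw [← isSq8_congr q₁ q₂]
      exact hsq

/-- **Soundness of the TIER 2x certificate `sig2xCheck`, residue form**: no integer vector primitive at `2` has
`2^N ∣ Q₁` and `2^N ∣ Q₂`. [cite: CremonaAlgorithms1997, §3.6] -/
theorem sig2xCheck_sound_mod {a b c : ℤ} {z : ℤ × ℤ × ℤ} {t₁ t₂ : ℤ} {N : ℕ} {ε s₁ s₀ p q : ℤ}
    (h : sig2xCheck a b c z t₁ t₂ N ε s₁ s₀ p q = true) (v : ℤ × ℤ × ℤ × ℤ)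
    (hprim : ¬ ((2 : ℤ) ∣ v.1 ∧ (2 : ℤ) ∣ v.2.1 ∧ (2 : ℤ) ∣ v.2.2.1 ∧ (2 : ℤ) ∣ v.2.2.2))
    (h0 : (2 : ℤ) ^ N ∣ (killQ a b c z t₁ t₂ v).1 ∧ (2 : ℤ) ^ N ∣ (killQ a b c z t₁ t₂ v).2) : False := by
  unfold sig2xCheck at h
  split_ifs at h
  · exact sig2xCheckE_sound_mod h v hprim h0
  · exact sig2xCheckU_sound_mod h v hprim h0

end Summit.BirchSwinnertonDyer.BirchSwinnertonDyer.Theorems.ShaPrimaryTransferSelmerCubicKill
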